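import Summits.Ventures.HodgeRepro2.T5UnitaryBound

/-!
# T5CartanU11 — the Cartan decomposition U(1,1) = K_W · A⁺ · K_W, kernel-checked

Support file for sub-step N4.3 = (R3) of the Tier-5 discharge of (N) (route/T5-N4-p5.md,
owner p5), written by seat p1 of the blind cell pub-hodge-repro2.

README §8(d) declaration: uses an L-value-free non-vanishing device: **no** — this file is
matrix algebra in support of the (N4.3.P1) CLAIM, a line on the record since N4.3 v1
(2026-08-25T01:25:26Z, STATUS l. 818).

## What is proved

`T5UnitaryBound` treats the indefinite unitary group U(1,1) = {g : gᴴ J g = J},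
J = diag(1, −1), and proves the CLAIM of (N4.3.P1) — Δ(g) := det(½(1 + g gᴴ)) = 1 + |g₁₀|² ≥ 1,
with equality iff g ∈ K_W — for EVERY g without any decomposition.  The proof text of
(N4.3.P1) reaches the same bound through the Cartan decomposition
U(W)(ℝ) = K_W A⁺ K_W, which N4.3 v10 lists among the facts NOT formalised.  This file closes
that item for the rank-one group:

* `exists_cartan` — every g ∈ U(1,1) is g = diag(u, w) · a_t · diag(1, v) with |u| = |w| = |v| = 1
  and t ≥ 0, where a_t = [[cosh t, sinh t], [sinh t, cosh t]] (the hyperbolic one-parameter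
  subgroup `hyperbolicC` of `T5UnitaryBound`); the parameter is t = arsinh |g₁₀|.
* `memU11_cartan` — conversely every such product lies in U(1,1) (`memU11_mul`,
  `memU11_diag`, `hyperbolicC_memU11`).
* `Delta_cartan` — Δ(diag(u, w) a_t diag(1, v)) = cosh² t: the cosh² t of row L2 of N4.3's
  LEAN table (`T5UnitaryBound.Delta_hyperbolicC`) IS the general value of Δ, through the Cartan
  parameter of the element.
* `cartan_param_unique` — the A⁺-parameter of a decomposition is t = arsinh |g₁₀| (so it is an
  invariant of g, not of the decomposition).
* `mul_conjTranspose_cartan` — g gᴴ = diag(u, w) · a_{2t} · diag(u, w)ᴴ, the conjugation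
  g g* = k a² k⁻¹ used in the proof of the CLAIM, with `hyperbolicC_add` (a_s a_t = a_{s+t}) and
  `conjTranspose_hyperbolicC` (a_tᴴ = a_t).
* the entry norms of an element of U(1,1): `norm_sq_entry_00` (|g₀₀|² = 1 + |g₁₀|²),
  `norm_entry_00_eq_11`, `norm_entry_01_eq_10`.

## What is NOT formalised (honest scope)

The Haar measure of U(1,1) in Cartan coordinates (the sinh(2t) dt Jacobian of the convergence
integral of (N4.3.P1)), the parabolic P(Y_n) and the standard section, the groups of higher
rank, and everything representation-theoretic.  Mathlib only (plus the cell's own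
`T5UnitaryBound`); no new definitions.
-/

namespace Summit.Ventures.HodgeRepro2.T5CartanU11

open Complex
open Summit.Ventures.HodgeRepro2.T5UnitaryBound

/-! ### The hyperbolic one-parameter subgroup -/

/-- a_s · a_t = a_{s+t}: `hyperbolicC` is a one-parameter subgroup. -/
theorem hyperbolicC_add (s t : ℝ) : hyperbolicC s * hyperbolicC t = hyperbolicC (s + t) := by
  simp only [hyperbolicC, Matrix.mul_fin_two, Real.cosh_add, Real.sinh_add]
  push_cast
  ring_nf

/-- a_0 = 1. -/
theorem hyperbolicC_zero : hyperbolicC 0 = 1 := by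
  simp [hyperbolicC, Matrix.one_fin_two]

/-- a_t is hermitian (real symmetric): a_tᴴ = a_t. -/
theorem conjTranspose_hyperbolicC (t : ℝ) : (hyperbolicC t).conjTranspose = hyperbolicC t := by
  ext i j
  fin_cases i <;> fin_cases j <;>
    simp [hyperbolicC, Complex.conj_ofReal, -Complex.ofReal_cosh, -Complex.ofReal_sinh]

/-- The product diag(u, w) · a_t · diag(1, v), entry by entry. -/
theorem cartan_entries (u w v : ℂ) (t : ℝ) :
    !![u, 0; 0, w] * hyperbolicC t * !![1, 0; 0, v] =
      !![u * (Real.cosh t : ℂ), u * (Real.sinh t : ℂ) * v;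
         w * (Real.sinh t : ℂ), w * (Real.cosh t : ℂ) * v] := by
  simp [hyperbolicC]

/-! ### Closure properties of U(1,1) -/

/-- U(1,1) is closed under multiplication. -/
theorem memU11_mul {g h : Matrix (Fin 2) (Fin 2) ℂ} (hg : MemU11 g) (hh : MemU11 h) :
    MemU11 (g * h) := by
  unfold MemU11 at *
  rw [Matrix.conjTranspose_mul]
  calc h.conjTranspose * g.conjTranspose * J * (g * h)
      = h.conjTranspose * (g.conjTranspose * J * g) * h := by simp only [Matrix.mul_assoc]
    _ = J := by rw [hg, hh]

/-- The conjugate transpose of a diagonal 2 × 2 matrix. -/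
theorem conjTranspose_diag (u w : ℂ) :
    (!![u, 0; 0, w] : Matrix (Fin 2) (Fin 2) ℂ).conjTranspose =
      !![(starRingEnd ℂ) u, 0; 0, (starRingEnd ℂ) w] := by
  ext i j
  fin_cases i <;> fin_cases j <;> simp [Matrix.conjTranspose_apply]

/-- The diagonal torus K_W = U(1) × U(1) lies in U(1,1). -/
theorem memU11_diag {u w : ℂ} (hu : ‖u‖ = 1) (hw : ‖w‖ = 1) : MemU11 !![u, 0; 0, w] := by
  have hu1 : (starRingEnd ℂ) u * u = 1 := by
    rw [mul_comm, Complex.mul_conj', hu]; simp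
  have hw1 : (starRingEnd ℂ) w * w = 1 := by
    rw [mul_comm, Complex.mul_conj', hw]; simp
  unfold MemU11
  rw [conjTranspose_diag]
  simp [J, hu1, hw1]

/-- Every product diag(u, w) · a_t · diag(1, v) with unimodular u, w, v lies in U(1,1). -/
theorem memU11_cartan {u w v : ℂ} (hu : ‖u‖ = 1) (hw : ‖w‖ = 1) (hv : ‖v‖ = 1) (t : ℝ) :
    MemU11 (!![u, 0; 0, w] * hyperbolicC t * !![1, 0; 0, v]) :=
  memU11_mul (memU11_mul (memU11_diag hu hw) (hyperbolicC_memU11 t))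
    (memU11_diag (by simp) hv)

/-! ### Entry norms of an element of U(1,1) -/

/-- |g₀₀|² = 1 + |g₁₀|² on U(1,1). -/
theorem norm_sq_entry_00 {g : Matrix (Fin 2) (Fin 2) ℂ} (hg : MemU11 g) :
    ‖g 0 0‖ ^ 2 = 1 + ‖g 1 0‖ ^ 2 := by
  have h : (starRingEnd ℂ) (g 0 0) * g 0 0 - (starRingEnd ℂ) (g 1 0) * g 1 0 = 1 := by
    simpa [J] using col_rel hg 0 0
  rw [← Complex.normSq_eq_conj_mul_self, ← Complex.normSq_eq_conj_mul_self,
    Complex.normSq_eq_norm_sq, Complex.normSq_eq_norm_sq] at h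
  have h' : (‖g 0 0‖ ^ 2 - ‖g 1 0‖ ^ 2 : ℝ) = 1 := by exact_mod_cast h
  linarith

/-- |g₁₁|² = 1 + |g₁₀|² on U(1,1). -/
theorem norm_sq_entry_11 {g : Matrix (Fin 2) (Fin 2) ℂ} (hg : MemU11 g) :
    ‖g 1 1‖ ^ 2 = 1 + ‖g 1 0‖ ^ 2 := by
  have h : g 1 0 * (starRingEnd ℂ) (g 1 0) - g 1 1 * (starRingEnd ℂ) (g 1 1) = -1 := by
    simpa [J] using row_rel hg 1 1
  rw [Complex.mul_conj', Complex.mul_conj'] at h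
  have h' : (‖g 1 0‖ ^ 2 - ‖g 1 1‖ ^ 2 : ℝ) = -1 := by exact_mod_cast h
  linarith

/-- |g₀₀| = |g₁₁| on U(1,1). -/
theorem norm_entry_00_eq_11 {g : Matrix (Fin 2) (Fin 2) ℂ} (hg : MemU11 g) :
    ‖g 0 0‖ = ‖g 1 1‖ :=
  (sq_eq_sq₀ (norm_nonneg _) (norm_nonneg _)).1
    ((norm_sq_entry_00 hg).trans (norm_sq_entry_11 hg).symm)

/-- |g₀₁| = |g₁₀| on U(1,1). -/
theorem norm_entry_01_eq_10 {g : Matrix (Fin 2) (Fin 2) ℂ} (hg : MemU11 g) :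
    ‖g 0 1‖ = ‖g 1 0‖ := by
  have h := normSq_offdiag hg
  rw [Complex.normSq_eq_norm_sq, Complex.normSq_eq_norm_sq] at h
  exact (sq_eq_sq₀ (norm_nonneg _) (norm_nonneg _)).1 h

/-- 1 ≤ |g₀₀| on U(1,1); in particular g₀₀ ≠ 0. -/
theorem one_le_norm_entry_00 {g : Matrix (Fin 2) (Fin 2) ℂ} (hg : MemU11 g) : 1 ≤ ‖g 0 0‖ := by
  have h := norm_sq_entry_00 hg
  nlinarith [norm_nonneg (g 0 0), sq_nonneg ‖g 1 0‖]

/-- The Cartan parameter t = arsinh |g₁₀| has cosh t = |g₀₀|. -/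
theorem cosh_arsinh_entry {g : Matrix (Fin 2) (Fin 2) ℂ} (hg : MemU11 g) :
    Real.cosh (Real.arsinh ‖g 1 0‖) = ‖g 0 0‖ := by
  rw [Real.cosh_arsinh, ← norm_sq_entry_00 hg, Real.sqrt_sq (norm_nonneg _)]

/-! ### The Cartan decomposition -/

/-- **Cartan decomposition of U(1,1).**  Every g with gᴴ J g = J is
g = diag(u, w) · a_t · diag(1, v) with |u| = |w| = |v| = 1 and t ≥ 0
(t = arsinh |g₁₀|, `cartan_param_unique`). -/
theorem exists_cartan {g : Matrix (Fin 2) (Fin 2) ℂ} (hg : MemU11 g) :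
    ∃ (u w v : ℂ) (t : ℝ), ‖u‖ = 1 ∧ ‖w‖ = 1 ∧ ‖v‖ = 1 ∧ 0 ≤ t ∧
      g = !![u, 0; 0, w] * hyperbolicC t * !![1, 0; 0, v] := by
  -- the entries and their relations
  have hA : ‖g 0 0‖ ^ 2 = 1 + ‖g 1 0‖ ^ 2 := norm_sq_entry_00 hg
  have hD : ‖g 1 1‖ ^ 2 = 1 + ‖g 1 0‖ ^ 2 := norm_sq_entry_11 hg
  have hbc : ‖g 0 1‖ = ‖g 1 0‖ := norm_entry_01_eq_10 hg
  have ha0 : g 0 0 ≠ 0 := by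
    intro h0
    have := one_le_norm_entry_00 hg
    rw [h0, norm_zero] at this
    linarith
  have hA0 : ((‖g 0 0‖ : ℝ) : ℂ) ≠ 0 := Complex.ofReal_ne_zero.2 (norm_ne_zero_iff.2 ha0)
  -- the Cartan parameter
  set t : ℝ := Real.arsinh ‖g 1 0‖ with ht_def
  have ht : 0 ≤ t := Real.arsinh_nonneg_iff.2 (norm_nonneg _)
  have hsinh : Real.sinh t = ‖g 1 0‖ := Real.sinh_arsinh _
  have hcosh : Real.cosh t = ‖g 0 0‖ := cosh_arsinh_entry hg
  by_cases hc : g 1 0 = 0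
  · -- the torus case: g is diagonal and t = 0
    have hb : g 0 1 = 0 := by
      rw [← norm_eq_zero, hbc, hc, norm_zero]
    have hc' : ‖g 1 0‖ = 0 := by rw [hc, norm_zero]
    have ha1 : ‖g 0 0‖ = 1 := by
      rw [hc', zero_pow two_ne_zero, add_zero] at hA
      exact (pow_eq_one_iff_of_nonneg (norm_nonneg _) two_ne_zero).1 hA
    have hd1 : ‖g 1 1‖ = 1 := by
      rw [hc', zero_pow two_ne_zero, add_zero] at hD
      exact (pow_eq_one_iff_of_nonneg (norm_nonneg _) two_ne_zero).1 hD
    refine ⟨g 0 0, g 1 1, 1, t, ha1, hd1, by simp, ht, ?_⟩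
    rw [cartan_entries, hcosh, hsinh, hc', ha1]
    ext i j
    fin_cases i <;> fin_cases j <;> simp [hb, hc]
  · -- the generic case: t > 0, the phases are read off the entries
    have hC0 : ((‖g 1 0‖ : ℝ) : ℂ) ≠ 0 := Complex.ofReal_ne_zero.2 (norm_ne_zero_iff.2 hc)
    set A : ℂ := ((‖g 0 0‖ : ℝ) : ℂ) with hA_def
    set C : ℂ := ((‖g 1 0‖ : ℝ) : ℂ) with hC_def
    set u : ℂ := g 0 0 / A with hu_def
    set w : ℂ := g 1 0 / C with hw_def
    set b₁ : ℂ := g 0 1 / C with hb₁_def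
    have hu : ‖u‖ = 1 := by
      rw [hu_def, norm_div, hA_def, Complex.norm_real, Real.norm_of_nonneg (norm_nonneg _),
        div_self (norm_ne_zero_iff.2 ha0)]
    have hw : ‖w‖ = 1 := by
      rw [hw_def, norm_div, hC_def, Complex.norm_real, Real.norm_of_nonneg (norm_nonneg _),
        div_self (norm_ne_zero_iff.2 hc)]
    have hb₁ : ‖b₁‖ = 1 := by
      rw [hb₁_def, norm_div, hC_def, Complex.norm_real, Real.norm_of_nonneg (norm_nonneg _),
        hbc, div_self (norm_ne_zero_iff.2 hc)]
    have hv : ‖b₁ * (starRingEnd ℂ) u‖ = 1 := by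
      rw [norm_mul, Complex.norm_conj, hb₁, hu, one_mul]
    -- the multiplicative relations
    have ha' : g 0 0 = A * u := by rw [hu_def, mul_comm, div_mul_cancel₀ _ hA0]
    have hc' : g 1 0 = C * w := by rw [hw_def, mul_comm, div_mul_cancel₀ _ hC0]
    have hb' : g 0 1 = C * b₁ := by rw [hb₁_def, mul_comm, div_mul_cancel₀ _ hC0]
    have hu1 : u * (starRingEnd ℂ) u = 1 := by rw [Complex.mul_conj', hu]; simp
    have hb₁1 : b₁ * (starRingEnd ℂ) b₁ = 1 := by rw [Complex.mul_conj', hb₁]; simp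
    -- the off-diagonal relation a c̄ = b d̄, conjugated
    have h01 : g 0 0 * (starRingEnd ℂ) (g 1 0) - g 0 1 * (starRingEnd ℂ) (g 1 1) = 0 := by
      have h := row_rel hg 0 1
      simpa [J] using h
    have hAc : (starRingEnd ℂ) A = A := by rw [hA_def, Complex.conj_ofReal]
    have hCc : (starRingEnd ℂ) C = C := by rw [hC_def, Complex.conj_ofReal]
    have E1 : A * (starRingEnd ℂ) u * (C * w) - C * (starRingEnd ℂ) b₁ * g 1 1 = 0 := by
      have h := congrArg (starRingEnd ℂ) h01
      rw [ha', hb', hc'] at h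
      simpa [map_sub, map_mul, Complex.conj_conj, hAc, hCc] using h
    have E2 : C * (A * (starRingEnd ℂ) u * w - (starRingEnd ℂ) b₁ * g 1 1) = 0 := by
      linear_combination E1
    have E3 : A * (starRingEnd ℂ) u * w = (starRingEnd ℂ) b₁ * g 1 1 :=
      sub_eq_zero.1 ((mul_eq_zero.1 E2).resolve_left hC0)
    refine ⟨u, w, b₁ * (starRingEnd ℂ) u, t, hu, hw, hv, ht, ?_⟩
    rw [cartan_entries, hcosh, hsinh]
    ext i j
    fin_cases i <;> fin_cases j
    · show g 0 0 = u * A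
      rw [ha']; ring
    · show g 0 1 = u * C * (b₁ * (starRingEnd ℂ) u)
      rw [hb']
      linear_combination (-(C * b₁)) * hu1
    · show g 1 0 = w * C
      rw [hc']; ring
    · show g 1 1 = w * A * (b₁ * (starRingEnd ℂ) u)
      linear_combination (-(g 1 1)) * hb₁1 + (-b₁) * E3

/-- The A⁺-parameter of a Cartan decomposition is t = arsinh |g₁₀|: it is an invariant of g. -/
theorem cartan_param_unique {g : Matrix (Fin 2) (Fin 2) ℂ} {u w v : ℂ} {t : ℝ}
    (hw : ‖w‖ = 1) (ht : 0 ≤ t)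
    (hg : g = !![u, 0; 0, w] * hyperbolicC t * !![1, 0; 0, v]) :
    t = Real.arsinh ‖g 1 0‖ := by
  have h10 : g 1 0 = w * (Real.sinh t : ℂ) := by
    rw [hg, cartan_entries]; simp
  rw [h10, norm_mul, hw, one_mul, Complex.norm_real,
    Real.norm_of_nonneg (Real.sinh_nonneg_iff.2 ht), Real.arsinh_sinh]

/-- Δ(diag(u, w) · a_t · diag(1, v)) = cosh² t: the value of the CLAIM of (N4.3.P1) on a Cartan
decomposition, through `T5UnitaryBound.Delta_eq`. -/
theorem Delta_cartan {u w v : ℂ} (hu : ‖u‖ = 1) (hw : ‖w‖ = 1) (hv : ‖v‖ = 1) (t : ℝ) :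
    Delta (!![u, 0; 0, w] * hyperbolicC t * !![1, 0; 0, v]) = (Real.cosh t : ℂ) ^ 2 := by
  rw [Delta_eq (memU11_cartan hu hw hv t), cartan_entries]
  have h10 : (!![u * (Real.cosh t : ℂ), u * (Real.sinh t : ℂ) * v;
      w * (Real.sinh t : ℂ), w * (Real.cosh t : ℂ) * v] : Matrix (Fin 2) (Fin 2) ℂ) 1 0 =
      w * (Real.sinh t : ℂ) := by simp
  rw [h10, Complex.normSq_mul, Complex.normSq_eq_norm_sq w, hw, Complex.normSq_ofReal,
    ← Complex.ofReal_pow, Real.cosh_sq']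
  push_cast
  ring

/-- Δ(g) = cosh² t for the Cartan parameter t = arsinh |g₁₀| of g ∈ U(1,1). -/
theorem Delta_eq_cosh_sq_arsinh {g : Matrix (Fin 2) (Fin 2) ℂ} (hg : MemU11 g) :
    Delta g = (Real.cosh (Real.arsinh ‖g 1 0‖) : ℂ) ^ 2 := by
  rw [Delta_eq hg, ← Complex.ofReal_pow, Real.cosh_sq', Real.sinh_arsinh,
    Complex.normSq_eq_norm_sq]
  push_cast
  ring

/-- diag(1, v) · diag(1, v)ᴴ = 1 for |v| = 1. -/
theorem diag_one_mul_conjTranspose {v : ℂ} (hv : ‖v‖ = 1) :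
    (!![1, 0; 0, v] : Matrix (Fin 2) (Fin 2) ℂ) * (!![1, 0; 0, v] : Matrix (Fin 2) (Fin 2) ℂ).conjTranspose = 1 := by
  have hv1 : v * (starRingEnd ℂ) v = 1 := by rw [Complex.mul_conj', hv]; simp
  rw [conjTranspose_diag]
  simp [hv1, Matrix.one_fin_two]

/-- g gᴴ = diag(u, w) · a_{2t} · diag(u, w)ᴴ for g = diag(u, w) · a_t · diag(1, v): the
conjugation g g* = k a² k⁻¹ used in the proof of the CLAIM of (N4.3.P1). -/
theorem mul_conjTranspose_cartan {u w v : ℂ} (hv : ‖v‖ = 1) (t : ℝ) :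
    (!![u, 0; 0, w] * hyperbolicC t * !![1, 0; 0, v]) *
        (!![u, 0; 0, w] * hyperbolicC t * !![1, 0; 0, v]).conjTranspose =
      !![u, 0; 0, w] * hyperbolicC (2 * t) * (!![u, 0; 0, w] : Matrix (Fin 2) (Fin 2) ℂ).conjTranspose := by
  rw [Matrix.conjTranspose_mul, Matrix.conjTranspose_mul, conjTranspose_hyperbolicC]
  calc !![u, 0; 0, w] * hyperbolicC t * !![1, 0; 0, v] *
        ((!![1, 0; 0, v] : Matrix (Fin 2) (Fin 2) ℂ).conjTranspose *
          (hyperbolicC t * (!![u, 0; 0, w] : Matrix (Fin 2) (Fin 2) ℂ).conjTranspose))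
      = !![u, 0; 0, w] * hyperbolicC t *
          (!![1, 0; 0, v] * (!![1, 0; 0, v] : Matrix (Fin 2) (Fin 2) ℂ).conjTranspose) *
          (hyperbolicC t * (!![u, 0; 0, w] : Matrix (Fin 2) (Fin 2) ℂ).conjTranspose) := by
        simp only [Matrix.mul_assoc]
    _ = !![u, 0; 0, w] * (hyperbolicC t * hyperbolicC t) *
          (!![u, 0; 0, w] : Matrix (Fin 2) (Fin 2) ℂ).conjTranspose := by
        rw [diag_one_mul_conjTranspose hv, Matrix.mul_one]
        simp only [Matrix.mul_assoc]
    _ = !![u, 0; 0, w] * hyperbolicC (2 * t) *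
          (!![u, 0; 0, w] : Matrix (Fin 2) (Fin 2) ℂ).conjTranspose := by
        rw [hyperbolicC_add, two_mul]


/-! ### v2 (append-only): the CLAIM's explicit formulas for EVERY g, through its Cartan parameter -/

/-- Re Δ(g) = cosh² t for the Cartan parameter t = arsinh |g₁₀| of g ∈ U(1,1). -/
theorem Delta_re_eq_cosh_sq {g : Matrix (Fin 2) (Fin 2) ℂ} (hg : MemU11 g) :
    (Delta g).re = Real.cosh (Real.arsinh ‖g 1 0‖) ^ 2 := by
  rw [Delta_re hg, Real.cosh_sq', Real.sinh_arsinh, Complex.normSq_eq_norm_sq]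

/-- |a(i(g,1))| = Δ(g)^{−1/2} = 1/cosh t for EVERY g ∈ U(1,1), t = arsinh |g₁₀| — the text's
«|a(i(a_t,1))| = 1/cosh t», checked there on the representatives a_t only. -/
theorem aNorm_eq_inv_cosh {g : Matrix (Fin 2) (Fin 2) ℂ} (hg : MemU11 g) :
    aNorm g = (Real.cosh (Real.arsinh ‖g 1 0‖))⁻¹ := by
  have hpos := Real.cosh_pos (Real.arsinh ‖g 1 0‖)
  unfold aNorm
  rw [Delta_re_eq_cosh_sq hg, Real.rpow_neg (by positivity), ← Real.sqrt_eq_rpow,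
    Real.sqrt_sq hpos.le]

/-- Δ(g)^{ε/2} = (cosh t)^ε for EVERY g ∈ U(1,1): the pointwise bound of (N4.3.P1) in the text's
form «Δ^{ε/2} = (cosh t)^ε (one hyperbolic plane)», for general g. -/
theorem Delta_re_rpow_half {g : Matrix (Fin 2) (Fin 2) ℂ} (hg : MemU11 g) (ε : ℝ) :
    (Delta g).re ^ (ε / 2) = Real.cosh (Real.arsinh ‖g 1 0‖) ^ ε := by
  have hpos := Real.cosh_pos (Real.arsinh ‖g 1 0‖)
  rw [Delta_re_eq_cosh_sq hg, ← Real.rpow_natCast, ← Real.rpow_mul hpos.le]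
  congr 1
  push_cast
  ring

/-- |a(i(g,1))|^x = (cosh t)^{−x} for EVERY g ∈ U(1,1) (x = Re s − ½ in the text). -/
theorem aNorm_rpow_eq_cosh_rpow {g : Matrix (Fin 2) (Fin 2) ℂ} (hg : MemU11 g) (x : ℝ) :
    aNorm g ^ x = Real.cosh (Real.arsinh ‖g 1 0‖) ^ (-x) := by
  rw [aNorm_rpow hg, ← Delta_re_rpow_half hg]

/-- On a Cartan decomposition with parameter t ≥ 0: |a(i(g,1))| = 1/cosh t. -/
theorem aNorm_cartan {u w v : ℂ} (hu : ‖u‖ = 1) (hw : ‖w‖ = 1) (hv : ‖v‖ = 1) {t : ℝ}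
    (ht : 0 ≤ t) :
    aNorm (!![u, 0; 0, w] * hyperbolicC t * !![1, 0; 0, v]) = (Real.cosh t)⁻¹ := by
  rw [aNorm_eq_inv_cosh (memU11_cartan hu hw hv t), ← cartan_param_unique hw ht rfl]

end Summit.Ventures.HodgeRepro2.T5CartanU11
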